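import Mathlib.Data.ZMod.Basic
import Mathlib.Data.Matrix.Mul
import Mathlib.LinearAlgebra.Matrix.Notation
import Mathlib.Algebra.BigOperators.Fin

/-!
# The public structure of the hidden offset is Learning-with-Rounding, exactly (T26: census Lemma B / B′)

REPRODUCTION / ANALYSIS OF A CLAIMED RESULT UNDER ADJUDICATION (withdrawn): Yilei Chen, *Quantum
Algorithms for Lattice Problems*, IACR ePrint 2024/555, version of 2024-04-18 [ChenQuantumLattice2024]
(the version carrying the author's note that Step 9 contains a bug), §3.2–3.3 (pp. 16–18: the LWE
instance as the `q`-ary lattice `L_q^⊥(A)`, `A = [2p₁t | Uᵀ | I_m]`, eq. (12) p. 17: the planted short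
vector `b = [−1, 2p₁sᵀ, 2p₁eᵀ]ᵀ`, `Ab ≡ 0 (mod q)`), Lemma 3.9 (p. 22: the lattice register is prepared
from its first `ℓ + 1` coordinates, the remaining `m` coordinates being `−[2p₁t | Uᵀ]·v₁ mod q`), and
Step 9 (§3.5.9, pp. 34–38) acting on the line ket with hidden offset `v′ = k′x − v`, `v ∈ L = D·L_q^⊥(A)`.
Learning with Rounding: A. Banerjee, C. Peikert, A. Rosen, *Pseudorandom Functions and Lattices*,
EUROCRYPT 2012 [BanerjeePeikertRosen2012] (Def. 3.1 with the rounding `⌊x⌉_p = ⌊(p/q)·x⌉` of eq. (2.1));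
the FLOOR rounding `⌊(p/q)·x⌋` used below is the variant of A. Bogdanov, S. Guo, D. Masny, S. Richelson,
A. Rosen, *On the Hardness of Learning with Rounding over Small Modulus*, TCC 2016-A [BogdanovEtAl2015]
(§2), which differs from `⌊·⌉_p` by the public shift `x ↦ x + q/(2p)`.  Bundle
`papers/QuantumAdvantage/lwe-quantum-autopsy/`, Part 2 (`REPAIR-CENSUS.md` §25.2 "Lemma B / Lemma B′",
§34; theorem **T26**; census row G7 — the one OPEN row, whose residual is an equivalence with the
target problem, §27.5 (iii)).  HONEST FRAMING: kernel-checked IDENTITIES about which public structure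
the hidden offset of a WITHDRAWN algorithm's Step-9 register carries on a fixed instance — the
dictionary that identifies that structure as Learning-with-Rounding labels of a fresh uniform secret;
NOT summit progress, no cryptanalytic claim in either direction, no new algorithm, no hardness claim;
quantum lower bounds are out of scope.

## Setting (census §24.3 / §25.2, Chen §3.2–3.3)

On a fixed instance the hidden lattice vector `ν = v/D ∈ L_q^⊥(A)` of a run is parametrised by its
FREE residues `ν_F = (ν₁, ν′) ∈ ℤ_q × ℤ_q^ℓ` (head and secret block; uniform and hidden, census
Lemma A), and every ERROR-block coordinate is the canonical lift `ν_i = lift_q(⟨r_i, ν_F⟩) ∈ [0,q)` of a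
PUBLIC linear form, `r_i = −(2p₁t_i, u_i)` (row `i` of `[2p₁t | Uᵀ]`, Lemma 3.9).  The Step-9 offset is
`ω = k′b − ν`, so on the error block `ω_i = 2p₁k′e_i − ν_i` (`b_i = 2p₁e_i`, eq. (12)); what the
register hides next to the datum are the digits `ω_i mod B` for divisors `B` of the register modulus
`DN` (`B ∈ {p₁, Dp₁, C, …}`, coprime to `q` in the case with content).  Throughout, `lift_q` is
`ZMod.val` and the floor label of `y ∈ ℤ_q` at modulus `B` is written INLINE as the natural number
`B * y.val / q` (`= ⌊B·lift_q(y)/q⌋ ∈ [0,B)`); this module introduces NO definition.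

## What is proved

**A. Lemma B, scalar form** (`Nat.Coprime B q`, `B⁻¹` the inverse of `B` in `ℤ_q`, `x ∈ ℤ_q`,
`y := B⁻¹x`).  `lift_q(x) = (B·lift_q(y)) mod q` (`val_eq_mul_val_inv_mul_mod`), hence the exact
integer identity `lift_q(x) + q·⌊B·lift_q(y)/q⌋ = B·lift_q(y)` (`val_add_mul_floorLabel`), hence

  `lift_q(x) ≡ −q · ⌊B·lift_q(B⁻¹x)/q⌋  (mod B)`                  (`natCast_val_eq_neg_mul_floorLabel`):

the base-`B` digit of the canonical lift of `x` IS, up to the fixed relabelling `θ_B(j) = −q·j` of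
`ℤ_B`, the floor-rounding label `⌊B⁻¹x⌋_{q→B}`; the label lies in `[0,B)` (`floorLabel_lt`); `θ_B` is a
bijection of `ℤ_B` when `gcd(q,B) = 1` (`thetaRelabel_bijective`), and conversely the label is read off the
digit: `⌊B·lift_q(B⁻¹x)/q⌋ ≡ −q⁻¹·lift_q(x) (mod B)` (`natCast_floorLabel_eq`).  If instead `g ∣ q`,
the digit modulo `g` is the image of `x` under the reduction map `ℤ_q → ℤ_g` — a LINEAR function, no
rounding (`natCast_val_dotProduct_eq_castHom`).

**B. Lemma B, vector form.**  For `r, ν ∈ ℤ_q^d`: `⟨B⁻¹r, ν⟩ = B⁻¹⟨r, ν⟩`, so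
`lift_q(⟨r,ν⟩) ≡ −q·⌊B·lift_q(⟨B⁻¹r, ν⟩)/q⌋ (mod B)` (`natCast_val_dotProduct_eq_neg_mul_floorLabel`):
the digit is `θ_B` of the floor-LWR label of the sample with PUBLIC vector `a = B⁻¹r` and SECRET `ν`.

**C. Lemma B′, change of secret.**  With the LWE relation `t_i = ⟨u_i, s⟩ + e_i` of the target
instance: `⟨r_i, ν_F⟩ = −(2p₁t_iν₁ + ⟨u_i, ν′⟩) = −(⟨u_i, ν″⟩ + 2p₁ν₁·e_i)` with
`ν″ := ν′ + (2p₁ν₁)·s` (`row_dotProduct_eq_of_lwe`, and in `(ℓ+1)`-vector form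
`cons_row_dotProduct_cons_eq_of_lwe`); the re-parametrisation `(ν₁, ν′) ↦ (ν₁, ν″)` is a bijection of
`ℤ_q × ℤ_q^ℓ` (`changeOfSecret_bijective`), so sums / uniform averages over `ν_F` are unchanged by it
(`sum_changeOfSecret`): conditional on the head residue `ν₁` (whose class is the datum) the error-block
residues are roundings of LWE-shaped samples on the target's OWN matrix `U`, with a FRESH uniform secret
`ν″` and "error" the target's error `e_i` times the hidden scalar `2p₁ν₁` — the census's statement of
what couples the hidden offsets to the secret direction, and of nothing else.

**D. The offset digits.**  For integers `K` (`= 2p₁k′`), `E` (`= e_i`) and the residue `x = ⟨r_i, ν_F⟩`: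
`(K·E − lift_q(x)) mod B = (K·E + q·⌊B·lift_q(B⁻¹x)/q⌋) mod B` (`offsetDigit_eq`) — the HIDDEN
class-position digit (`B = C`) is an LWR label of `ν_F`, relabelled and shifted by `2p₁k′e_i`; and when
`B ∣ K` (the KNOWABLE digit `B = p₁`, since `p₁ ∣ 2p₁k′`) the shift vanishes:
`(K·E − lift_q(x)) mod p₁ = q·⌊p₁·lift_q(p₁⁻¹x)/q⌋ mod p₁` (`offsetDigit_eq_of_dvd`) — the run's
transcript hands an instance-aware observer noiseless floor-LWR_{q→p₁} labels of `ν_F` for free, one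
per error coordinate, exactly as census §25.2 (ii) states.

## What is NOT here

The counting heuristic (B2) (how many labels pin `ν_F`) and the conditional disposal (B3) (decision /
search LWR with `m_e` samples is at least as hard as LWE of the same shape, [BogdanovEtAl2015] Thm 1 /
Thm 3 / Lemma 5 — cited theorems, not formalised); the open point (R1) of row G7 (no reduction from a
coherent instance-aware Step-9 measurement to LWE/LWR is known); Lemma A (the law of `ν_F`); any
statement about quantum states (the digit-observer caps are T17/T21/T25); any hardness claim.
-/

namespace Literature.Computability.Cryptography.Chen2024

open scoped BigOperators

/-! ### A. Lemma B — scalar form -/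

section Scalar

variable (q B : ℕ) [NeZero q]

/-- `lift_q(x) = (B · lift_q(B⁻¹x)) mod q` for `B` a unit modulo `q`. [folklore] -/
theorem val_eq_mul_val_inv_mul_mod (hB : Nat.Coprime B q) (x : ZMod q) :
    x.val = B * ((B : ZMod q)⁻¹ * x).val % q := by
  have h : ((B * ((B : ZMod q)⁻¹ * x).val : ℕ) : ZMod q) = x := by
    push_cast
    rw [ZMod.natCast_zmod_val, ← mul_assoc, ZMod.coe_mul_inv_eq_one B hB, one_mul]
  conv_lhs => rw [← h]
  rw [ZMod.val_natCast]

/-- **Lemma B, integer form.**  `lift_q(x) + q · ⌊B·lift_q(B⁻¹x)/q⌋ = B · lift_q(B⁻¹x)` — Euclidean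
division of `B·lift_q(B⁻¹x)` by `q` has remainder `lift_q(x)` and quotient the floor label.
[cite: BogdanovEtAl2015, §2 (floor rounding `⌊·⌋_p`); BanerjeePeikertRosen2012, Def. 3.1, eq. (2.1)] -/
theorem val_add_mul_floorLabel (hB : Nat.Coprime B q) (x : ZMod q) :
    x.val + q * (B * ((B : ZMod q)⁻¹ * x).val / q) = B * ((B : ZMod q)⁻¹ * x).val := by
  have h := Nat.mod_add_div (B * ((B : ZMod q)⁻¹ * x).val) q
  rwa [← val_eq_mul_val_inv_mul_mod q B hB x] at h

/-- **Lemma B (census §25.2), scalar form.**  For `gcd(B, q) = 1` and every `x ∈ ℤ_q`: the base-`B`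
digit of the canonical lift of `x` is `−q` times the floor-rounding label of `B⁻¹x`,
`lift_q(x) ≡ −q·⌊B·lift_q(B⁻¹x)/q⌋ (mod B)`.
[cite: ChenQuantumLattice2024, §3.2–3.3 pp. 16–18, Lemma 3.9 p. 22; BanerjeePeikertRosen2012, Def. 3.1;
BogdanovEtAl2015, §2; census §25.2 Lemma B] -/
theorem natCast_val_eq_neg_mul_floorLabel (hB : Nat.Coprime B q) (x : ZMod q) :
    ((x.val : ℕ) : ZMod B) = -(((q * (B * ((B : ZMod q)⁻¹ * x).val / q) : ℕ) : ZMod B)) := by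
  rw [eq_neg_iff_add_eq_zero, ← Nat.cast_add, val_add_mul_floorLabel q B hB x, Nat.cast_mul,
    ZMod.natCast_self, zero_mul]

/-- The floor label lies in `[0, B)`. [cite: BogdanovEtAl2015, §2] -/
theorem floorLabel_lt (hBpos : 0 < B) (y : ZMod q) : B * y.val / q < B := by
  rw [Nat.div_lt_iff_lt_mul (NeZero.pos q)]
  exact Nat.mul_lt_mul_of_pos_left (ZMod.val_lt y) hBpos

omit [NeZero q] in
/-- The relabelling `θ_B : j ↦ −q·j` is a bijection of `ℤ_B` when `gcd(q, B) = 1`. [folklore] -/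
theorem thetaRelabel_bijective (hq : Nat.Coprime q B) :
    Function.Bijective fun j : ZMod B => -((q : ZMod B) * j) := by
  rw [Function.bijective_iff_has_inverse]
  refine ⟨fun j => -((q : ZMod B)⁻¹ * j), fun j => ?_, fun j => ?_⟩
  · show -((q : ZMod B)⁻¹ * -((q : ZMod B) * j)) = j
    rw [mul_neg, neg_neg, ← mul_assoc, mul_comm ((q : ZMod B)⁻¹), ZMod.coe_mul_inv_eq_one q hq,
      one_mul]
  · show -((q : ZMod B) * -((q : ZMod B)⁻¹ * j)) = j
    rw [mul_neg, neg_neg, ← mul_assoc, ZMod.coe_mul_inv_eq_one q hq, one_mul]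

/-- **Lemma B read backwards**: the floor label is `−q⁻¹` times the digit,
`⌊B·lift_q(B⁻¹x)/q⌋ ≡ −q⁻¹·lift_q(x) (mod B)` (`gcd(B,q) = 1` both ways round).
[cite: BogdanovEtAl2015, §2; census §25.2 Lemma B] -/
theorem natCast_floorLabel_eq (hB : Nat.Coprime B q) (hq : Nat.Coprime q B) (x : ZMod q) :
    (((B * ((B : ZMod q)⁻¹ * x).val / q : ℕ) : ZMod B)) = -((q : ZMod B)⁻¹ * ((x.val : ℕ) : ZMod B)) := by
  rw [natCast_val_eq_neg_mul_floorLabel q B hB x, mul_neg, neg_neg, Nat.cast_mul, ← mul_assoc,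
    mul_comm ((q : ZMod B)⁻¹), ZMod.coe_mul_inv_eq_one q hq, one_mul]

end Scalar

/-! ### B. Lemma B — vector form (the public rows) -/

section Vector

variable (q B : ℕ) [NeZero q] {d : Type*} [Fintype d]

/-- **Lemma B (census §25.2), vector form.**  For `gcd(B,q) = 1` and `r, ν ∈ ℤ_q^d`:
`lift_q(⟨r, ν⟩) ≡ −q · ⌊B·lift_q(⟨B⁻¹r, ν⟩)/q⌋ (mod B)` — the base-`B` digit of the canonical lift of
the public linear form `⟨r, ν⟩` is `θ_B` of the floor-LWR label `⌊⟨a, ν⟩⌋_{q→B}` of the sample with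
public vector `a = B⁻¹r` and secret `ν`.  Applied with `r = r_i` (row `i` of `−[2p₁t | Uᵀ]`) and
`ν = ν_F`: the error-block coordinate `ν_i = lift_q(⟨r_i, ν_F⟩)` of the hidden lattice vector.
[cite: ChenQuantumLattice2024, §3.2–3.3 pp. 16–18, Lemma 3.9 p. 22, eq. (12) p. 17;
BanerjeePeikertRosen2012, Def. 3.1; BogdanovEtAl2015, §2; census §25.2 Lemma B] -/
theorem natCast_val_dotProduct_eq_neg_mul_floorLabel (hB : Nat.Coprime B q) (r ν : d → ZMod q) :
    (((r ⬝ᵥ ν).val : ℕ) : ZMod B)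
      = -(((q * (B * ((((B : ZMod q)⁻¹ • r) ⬝ᵥ ν).val) / q) : ℕ) : ZMod B)) := by
  rw [smul_dotProduct, smul_eq_mul]
  exact natCast_val_eq_neg_mul_floorLabel q B hB _

/-- The integer form on rows: `lift_q(⟨r,ν⟩) + q·⌊B·lift_q(⟨B⁻¹r,ν⟩)/q⌋ = B·lift_q(⟨B⁻¹r,ν⟩)`.
[cite: BogdanovEtAl2015, §2; census §25.2 Lemma B] -/
theorem val_dotProduct_add_mul_floorLabel (hB : Nat.Coprime B q) (r ν : d → ZMod q) :
    (r ⬝ᵥ ν).val + q * (B * (((B : ZMod q)⁻¹ • r) ⬝ᵥ ν).val / q)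
      = B * (((B : ZMod q)⁻¹ • r) ⬝ᵥ ν).val := by
  have h := val_add_mul_floorLabel q B hB (r ⬝ᵥ ν)
  rwa [← smul_eq_mul ((B : ZMod q)⁻¹), ← smul_dotProduct] at h

/-- The complementary case `g ∣ q` (Chen, p. 18: "we don't need to avoid `q, p₁` such that `q ∈ 2p₁ℤ`"),
on rows: the digit modulo `g` of `lift_q(⟨r, ν⟩)` is the linear form
`⟨r mod g, ν mod g⟩` over `ℤ_g` — an exact (noiseless, unrounded) linear relation in `ν mod g`.
[cite: ChenQuantumLattice2024, §3.3 p. 18; census §25.2] -/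
theorem natCast_val_dotProduct_eq_castHom {g : ℕ} (hg : g ∣ q) (r ν : d → ZMod q) :
    (((r ⬝ᵥ ν).val : ℕ) : ZMod g)
      = (fun i => ZMod.castHom hg (ZMod g) (r i)) ⬝ᵥ (fun i => ZMod.castHom hg (ZMod g) (ν i)) := by
  have h : (((r ⬝ᵥ ν).val : ℕ) : ZMod g) = ZMod.castHom hg (ZMod g) (r ⬝ᵥ ν) := by
    rw [ZMod.castHom_apply, ZMod.cast_eq_val]
  rw [h, RingHom.map_dotProduct]
  rfl

end Vector

/-! ### C. Lemma B′ — change of secret: the rows become the target's own `U` -/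

section ChangeOfSecret

variable {R : Type*} [CommRing R] {d : Type*} [Fintype d]

/-- **Lemma B′ (census §25.2).**  If `t = ⟨u, s⟩ + e` (an LWE sample of the target instance: row `u`
of `Uᵀ`, secret `s`, error `e`), then for every head residue `ν₁`, secret-block residues `ν′` and
scalar `c` (`= 2p₁`):  `−(c·t·ν₁ + ⟨u, ν′⟩) = −(⟨u, ν′ + (c·ν₁)·s⟩ + c·ν₁·e)` — the public linear form
`⟨r, ν_F⟩`, `r = −(c·t, u)`, is an LWE-shaped sample on the target's own row `u` with the shifted secret
`ν″ = ν′ + (cν₁)·s` and "error" `e` scaled by the hidden multiplier `cν₁`.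
[cite: ChenQuantumLattice2024, §3.2 pp. 16–17 (LWE samples `t = Uᵀs + e`), eq. (12) p. 17, Lemma 3.9
p. 22; census §25.2 Lemma B′] -/
theorem row_dotProduct_eq_of_lwe (c ν₁ t e : R) (u s ν' : d → R)
    (ht : t = u ⬝ᵥ s + e) :
    -(c * t * ν₁ + u ⬝ᵥ ν') = -(u ⬝ᵥ (ν' + (c * ν₁) • s) + c * ν₁ * e) := by
  rw [ht, dotProduct_add, dotProduct_smul, smul_eq_mul]
  ring

/-- Lemma B′ in `(ℓ+1)`-vector form: with the public row `r = (−c·t, −u) ∈ ℤ_q^{ℓ+1}` and the free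
residues `ν_F = (ν₁, ν′)`, `⟨r, ν_F⟩ = −(⟨u, ν′ + (cν₁)·s⟩ + cν₁·e)`.
[cite: ChenQuantumLattice2024, Lemma 3.9 p. 22, eq. (12) p. 17; census §25.2 Lemma B′] -/
theorem cons_row_dotProduct_cons_eq_of_lwe {ℓ : ℕ} (c ν₁ t e : R)
    (u s ν' : Fin ℓ → R) (ht : t = u ⬝ᵥ s + e) :
    Matrix.vecCons (-(c * t)) (-u) ⬝ᵥ Matrix.vecCons ν₁ ν'
      = -(u ⬝ᵥ (ν' + (c * ν₁) • s) + c * ν₁ * e) := by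
  rw [Matrix.cons_dotProduct_cons, neg_dotProduct, ← row_dotProduct_eq_of_lwe c ν₁ t e u s ν' ht]
  ring

omit [Fintype d] in
/-- The re-parametrisation `(ν₁, ν′) ↦ (ν₁, ν′ + (cν₁)·s)` of the free residues is a bijection (for
every fixed `c`, `s`) — so a uniform `ν_F` stays uniform: the shifted secret `ν″` of Lemma B′ is again
fresh and uniform, jointly with `ν₁` (census §25.2 Lemma B′). [folklore] -/
theorem changeOfSecret_bijective (c : R) (s : d → R) :
    Function.Bijective fun p : R × (d → R) => (p.1, p.2 + (c * p.1) • s) := by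
  rw [Function.bijective_iff_has_inverse]
  refine ⟨fun p => (p.1, p.2 - (c * p.1) • s), fun p => ?_, fun p => ?_⟩
  · simp
  · simp

/-- Sums (hence uniform averages and counting probabilities) over the free residues are invariant under
the change of secret of Lemma B′ (census §25.2). [folklore] -/
theorem sum_changeOfSecret [Fintype R] [DecidableEq d] {M : Type*} [AddCommMonoid M]
    (c : R) (s : d → R) (F : R × (d → R) → M) :
    ∑ p : R × (d → R), F (p.1, p.2 + (c * p.1) • s) = ∑ p, F p :=
  (changeOfSecret_bijective c s).sum_comp F

end ChangeOfSecret

/-! ### D. The digits of the Step-9 offset on the error block -/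

section OffsetDigits

variable (q B : ℕ) [NeZero q]

/-- **The hidden class-position digit is a shifted LWR label.**  With `ω_i = K·E − ν_i` (`K = 2p₁k′`,
`E = e_i`, `ν_i = lift_q(x)`, `x = ⟨r_i, ν_F⟩`) and `gcd(B, q) = 1`:
`ω_i ≡ K·E + q·⌊B·lift_q(B⁻¹x)/q⌋ (mod B)` — relabelled floor-LWR label of `ν_F` plus the shift
`2p₁k′e_i mod B` (`k′ mod B` knowable, `e_i` the target's error).
[cite: ChenQuantumLattice2024, §3.5.9 pp. 34–38 (offset `v′ = k′x − v`), eq. (12) p. 17 (`b_i = 2p₁e_i`);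
census §25.2 (i)] -/
theorem offsetDigit_eq (hB : Nat.Coprime B q) (K E : ℤ) (x : ZMod q) :
    (((K * E - (x.val : ℤ) : ℤ)) : ZMod B)
      = ((K * E : ℤ) : ZMod B) + (((q * (B * ((B : ZMod q)⁻¹ * x).val / q) : ℕ) : ZMod B)) := by
  have h := natCast_val_eq_neg_mul_floorLabel q B hB x
  push_cast at h ⊢
  rw [h]
  ring

/-- **The knowable digit is a pure LWR label.**  If moreover `B ∣ K` (the digit modulo `p₁`: `p₁ ∣ 2p₁k′`),
the shift vanishes: `ω_i ≡ q·⌊B·lift_q(B⁻¹x)/q⌋ (mod B)` — the run's transcript hands an instance-aware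
observer one noiseless floor-LWR_{q→p₁} label of the fresh secret `ν_F` per error coordinate.
[cite: ChenQuantumLattice2024, Claim 3.14 pp. 33–34 (Step 8), eq. (12) p. 17; census §25.2 (ii)] -/
theorem offsetDigit_eq_of_dvd (hB : Nat.Coprime B q) (K E : ℤ) (hK : (B : ℤ) ∣ K) (x : ZMod q) :
    (((K * E - (x.val : ℤ) : ℤ)) : ZMod B)
      = (((q * (B * ((B : ZMod q)⁻¹ * x).val / q) : ℕ) : ZMod B)) := by
  rw [offsetDigit_eq q B hB K E x, Int.cast_mul, (ZMod.intCast_zmod_eq_zero_iff_dvd K B).2 hK,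
    zero_mul, zero_add]

/-- The knowable digit read backwards: the LWR label modulo `B` is `q⁻¹·ω_i` (`gcd(q,B) = 1`).
[cite: ChenQuantumLattice2024, Claim 3.14 pp. 33–34, eq. (12) p. 17; census §25.2 (ii)] -/
theorem floorLabel_eq_inv_mul_offsetDigit (hB : Nat.Coprime B q) (hq : Nat.Coprime q B) (K E : ℤ)
    (hK : (B : ℤ) ∣ K) (x : ZMod q) :
    (((B * ((B : ZMod q)⁻¹ * x).val / q : ℕ) : ZMod B))
      = (q : ZMod B)⁻¹ * (((K * E - (x.val : ℤ) : ℤ)) : ZMod B) := by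
  rw [offsetDigit_eq_of_dvd q B hB K E hK x, Nat.cast_mul, ← mul_assoc, mul_comm ((q : ZMod B)⁻¹),
    ZMod.coe_mul_inv_eq_one q hq, one_mul]

end OffsetDigits

end Literature.Computability.Cryptography.Chen2024
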